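import Summits.RiemannHypothesis.RiemannHypothesis.Theorems.MotivicDoorFfHodgeIndex

/-!
# Motivic door, ff side: the Hodge index theorem as "exactly one positive square"

pub-rhdoor / FFCAL (gen 4, file 3).  Honest framing of the cell: lottery ticket at the motivic door;
RH probability negligible; this file proves nothing about RH.  It completes the kernel DICTIONARY of
`MotivicDoorFfHodgeIndex` by the basis-free form in which the Hodge index theorem is usually quoted:
*the intersection form has exactly one positive square*.

For the formal Néron–Severi window `span{H, V, Γ_0, …, Γ_M}` of a datum `(q, h)` with its symmetric
form `inter q h M` (Gram `nsGram q h M`):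

* `inter_lincomb` — the binary expansion `(a u + b v)² = a² u² + 2ab u·v + b² v²`;
* `inter_hv_self` — `(H + V)² = 2 > 0`: the positive index is AT LEAST one, for every datum;
* `hodgeIndex_iff_posIndex_le_one` — Hodge index in hyperplane form
  (`x·H + x·V = 0 → x² ≤ 0`) ⟺ NO PLANE IS POSITIVE DEFINITE (every pair `u, v` has a non-trivial
  combination with `(a u + b v)² ≤ 0`), i.e. the positive index is AT MOST one — pure bilinear algebra,
  the pivot being the ample-like class `H + V`;
* `posIndex_le_one_iff_posSemidef` — ⟺ `(weilWindowForm q h M).PosSemidef` (`q ≥ 1`);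
* `posIndex_le_one_of_ffRH`, `ffRH_iff_forall_posIndex_le_one`, `ffRH_iff_posIndex_le_one_lastWindow`
  — RH(q,h) ⟺ "exactly one positive square" on every window / on the single window `M = 2g − 1`
  (honest datum: `deg h = 2g ≥ 2`, coefficient functional equation).

And the RADICAL (the null classes):

* `nsGram_mulVec_inr_add_realLattice_mulVec` — the primed rows `(G x)_{Γ_m} + (S_M c)_m = q^m x·H + x·V`;
* `nsGram_mulVec_eq_zero_iff` — `x = aH + bV + Σ c_m Γ_m` is numerically trivial ⟺ `x·H = x·V = 0` and
  `S_M c = 0` (every datum): the null classes are exactly the Castelnuovo–Severi EQUALITY relations;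
* `realLattice_mulVec_eq_zero_iff_weil` (`S_M c = 0 ⟺ T_M (D c) = 0`), `realLattice_mulVec_eq_zero_iff_frob`
  and `nsGram_mulVec_eq_zero_iff_frob` — under RH(q,h): ⟺ `Σ c_m α^m = 0` at every Frobenius
  eigenvalue `α` (the cliff file's kernel theorem, transported): radical = Frobenius relations.

So of FFCAL's certified inertia triple `(n₊, n₀, n₋) = (1, M+1−r, 1+r)` (221 + 2195 windows, exact
integer LDLᵀ, DATA/CERTIFIED) the entry `n₊ = 1` is now a theorem for every datum satisfying RH(q,h)
(in particular every L-polynomial of a curve, by Weil's theorem), and `n₀` is identified with the space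
of polynomials of degree `≤ M` vanishing on the Frobenius eigenvalues (dimension `(M+1−D)⁺` by the cliff
file; the dimension count itself and `n₋` are not restated as decls here).

HONEST GRADE: [folklore] — Hodge index theorem phrasing (Hartshorne V, Thm 1.9 and Ex. 1.9–1.10
[corpus: book:hartshorne1977-algebraic-geometry pp. 430–431]); new only as a kernel-checked statement
bound BY NAME to the tree's `weilWindowForm`.  No RH claim.
-/

set_option linter.dupNamespace false

open Polynomial Matrix Finset
open scoped ComplexOrder

open Summit.RiemannHypothesis.RiemannHypothesis.Theorems.PfPersistence.FfAngleTwin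
open Summit.RiemannHypothesis.RiemannHypothesis.Theorems.MotivicDoor.FunctionField
open Summit.RiemannHypothesis.RiemannHypothesis.Theorems.MotivicDoor.FfLatticeFloor
open Summit.RiemannHypothesis.RiemannHypothesis.Theorems.MotivicDoor.FfRealLattice
open Summit.RiemannHypothesis.RiemannHypothesis.Theorems.MotivicDoor.FfCliff
open Summit.RiemannHypothesis.RiemannHypothesis.Theorems.MotivicDoor.FfHodgeIndex

namespace Summit.RiemannHypothesis.RiemannHypothesis.Theorems.MotivicDoor.FfHodgeSignature

variable (q : ℕ) (h : ℤ[X]) (M : ℕ)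

/-- The class `H + V` as a coordinate vector. [folklore] -/
def hv (M : ℕ) : NSIndex M → ℝ := Pi.single (Sum.inl 0) 1 + Pi.single (Sum.inl 1) 1

/-- Binary expansion of the quadratic form: `(a u + b v)² = a² u² + 2ab u·v + b² v²`. [folklore] -/
theorem inter_lincomb (u v : NSIndex M → ℝ) (a b : ℝ) :
    inter q h M (a • u + b • v) (a • u + b • v)
      = a ^ 2 * inter q h M u u + 2 * a * b * inter q h M u v + b ^ 2 * inter q h M v v := by
  have hc : v ⬝ᵥ (nsGram q h M *ᵥ u) = u ⬝ᵥ (nsGram q h M *ᵥ v) := inter_comm q h M v u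
  simp only [inter, Matrix.mulVec_add, Matrix.mulVec_smul, dotProduct_add, dotProduct_smul,
    add_dotProduct, smul_dotProduct, smul_eq_mul, hc]
  ring

/-- `degH` is linear. [folklore] -/
theorem degH_lincomb (u v : NSIndex M → ℝ) (a b : ℝ) :
    degH q h M (a • u + b • v) = a * degH q h M u + b * degH q h M v := by
  simp [degH, Matrix.mulVec_add, Matrix.mulVec_smul]

/-- `degV` is linear. [folklore] -/
theorem degV_lincomb (u v : NSIndex M → ℝ) (a b : ℝ) :
    degV q h M (a • u + b • v) = a * degV q h M u + b * degV q h M v := by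
  simp [degV, Matrix.mulVec_add, Matrix.mulVec_smul]

/-- `(H + V)·H = 1`. [folklore] -/
theorem degH_hv : degH q h M (hv M) = 1 := by
  simp [degH_eq, hv]

/-- `(H + V)·V = 1`. [folklore] -/
theorem degV_hv : degV q h M (hv M) = 1 := by
  simp [degV_eq, hv]

/-- `x·(H + V) = x·H + x·V`. [folklore] -/
theorem inter_hv (x : NSIndex M → ℝ) : inter q h M x (hv M) = degH q h M x + degV q h M x := by
  rw [inter_comm]
  show (Pi.single (Sum.inl 0) 1 + Pi.single (Sum.inl 1) 1) ⬝ᵥ (nsGram q h M *ᵥ x) = _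
  rw [add_dotProduct]
  exact congrArg₂ (· + ·) (inter_single_H q h M x) (inter_single_V q h M x)

/-- **The positive index is at least one**: `(H + V)² = 2`. [folklore] -/
theorem inter_hv_self : inter q h M (hv M) (hv M) = 2 := by
  rw [inter_hv, degH_hv, degV_hv]; norm_num

/-- **HODGE INDEX ⟺ POSITIVE INDEX ≤ 1.**  The hyperplane form (`x·H + x·V = 0 → x² ≤ 0`) is equivalent
to: no two classes `u, v` span a positive definite plane — every pair has a combination
`a u + b v`, `(a, b) ≠ (0, 0)`, of non-positive square.  (⇒: a plane meets the hyperplane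
`{x·(H+V) = 0}`; ⇐: a class `x ⊥ H + V` with `x² > 0` would span, with `H + V`, a positive definite
plane, since `(a x + b (H+V))² = a² x² + 2 b²`.)  Together with `inter_hv_self` this says: the form has
EXACTLY ONE positive square. [folklore] -/
theorem hodgeIndex_iff_posIndex_le_one :
    (∀ x : NSIndex M → ℝ, degH q h M x + degV q h M x = 0 → inter q h M x x ≤ 0)
      ↔ ∀ u v : NSIndex M → ℝ, ∃ a b : ℝ, (a ≠ 0 ∨ b ≠ 0)
          ∧ inter q h M (a • u + b • v) (a • u + b • v) ≤ 0 := by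
  constructor
  · intro hH u v
    by_cases hu : degH q h M u + degV q h M u = 0
    · refine ⟨1, 0, Or.inl one_ne_zero, ?_⟩
      have e : (1 : ℝ) • u + (0 : ℝ) • v = u := by simp
      rw [e]
      exact hH u hu
    · refine ⟨degH q h M v + degV q h M v, -(degH q h M u + degV q h M u),
        Or.inr (neg_ne_zero.mpr hu), hH _ ?_⟩
      rw [degH_lincomb, degV_lincomb]
      ring
  · intro hP x hx
    by_contra hpos
    push Not at hpos
    obtain ⟨a, b, hab, hle⟩ := hP x (hv M)
    rw [inter_lincomb, inter_hv, hx, inter_hv_self] at hle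
    rcases hab with ha | hb
    · have : 0 < a ^ 2 * inter q h M x x := mul_pos (by positivity) hpos
      nlinarith [sq_nonneg b]
    · have : 0 < b ^ 2 := by positivity
      nlinarith [mul_nonneg (sq_nonneg a) hpos.le]

/-- **POSITIVE INDEX ≤ 1 ⟺ `T_M(q,h) ⪰ 0`** (`q ≥ 1`). [folklore] -/
theorem posIndex_le_one_iff_posSemidef (hq : 0 < q) :
    (∀ u v : NSIndex M → ℝ, ∃ a b : ℝ, (a ≠ 0 ∨ b ≠ 0)
        ∧ inter q h M (a • u + b • v) (a • u + b • v) ≤ 0)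
      ↔ (weilWindowForm (q : ℝ) h M).PosSemidef :=
  (hodgeIndex_iff_posIndex_le_one q h M).symm.trans (hodgeIndex_iff_posSemidef q h M hq)

/-- RH(q,h) ⇒ exactly one positive square on every window (the `n₊ = 1` entry of FFCAL's certified
inertia triple, as a theorem). [folklore] -/
theorem posIndex_le_one_of_ffRH (hq : 0 < q) (hRH : ∀ α ∈ frobRoots h, ‖α‖ = Real.sqrt q) (M : ℕ) :
    ∀ u v : NSIndex M → ℝ, ∃ a b : ℝ, (a ≠ 0 ∨ b ≠ 0)
        ∧ inter q h M (a • u + b • v) (a • u + b • v) ≤ 0 :=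
  (hodgeIndex_iff_posIndex_le_one q h M).1 (hodgeIndex_of_ffRH q h hq hRH M)

/-- **RH(q,h) ⟺ "EXACTLY ONE POSITIVE SQUARE" ON ALL WINDOWS** (honest datum). [folklore] -/
theorem ffRH_iff_forall_posIndex_le_one (hq : 0 < q) {g : ℕ} (hdeg : h.natDegree = 2 * g)
    (hFE : ∀ i j, i + j = 2 * g → (q : ℤ) ^ g * h.coeff j = (q : ℤ) ^ i * h.coeff i) :
    (∀ α ∈ frobRoots h, ‖α‖ = Real.sqrt q)
      ↔ ∀ M : ℕ, ∀ u v : NSIndex M → ℝ, ∃ a b : ℝ, (a ≠ 0 ∨ b ≠ 0)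
          ∧ inter q h M (a • u + b • v) (a • u + b • v) ≤ 0 := by
  rw [ffRH_iff_forall_hodgeIndex q h hq hdeg hFE]
  exact forall_congr' fun M => hodgeIndex_iff_posIndex_le_one q h M

/-- **RH(q,h) ⟺ "EXACTLY ONE POSITIVE SQUARE" ON THE SINGLE WINDOW `M = 2g − 1`** (honest datum,
`g ≥ 1`). [folklore] -/
theorem ffRH_iff_posIndex_le_one_lastWindow (hq : 0 < q) {g : ℕ} (hg : 1 ≤ g)
    (hdeg : h.natDegree = 2 * g)
    (hFE : ∀ i j, i + j = 2 * g → (q : ℤ) ^ g * h.coeff j = (q : ℤ) ^ i * h.coeff i) :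
    (∀ α ∈ frobRoots h, ‖α‖ = Real.sqrt q)
      ↔ ∀ u v : NSIndex (2 * g - 1) → ℝ, ∃ a b : ℝ, (a ≠ 0 ∨ b ≠ 0)
          ∧ inter q h (2 * g - 1) (a • u + b • v) (a • u + b • v) ≤ 0 :=
  (ffRH_iff_hodgeIndex_lastWindow q h hq hg hdeg hFE).trans
    (hodgeIndex_iff_posIndex_le_one q h (2 * g - 1))

/-! ### The radical of the window form: numerically trivial classes = Frobenius relations -/

/-- The `Γ`-rows of the Gram matrix in "primed" form:
`(G x)_{Γ_m} + (S_M c)_m = q^m (x·H) + (x·V)`, `c` the `Γ`-coordinates of `x` — i.e.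
`Γ'_m := Γ_m − q^m H − V` satisfies `Γ'_m · x = −(S_M c)_m` on classes of degree `(0,0)`. [folklore] -/
theorem nsGram_mulVec_inr_add_realLattice_mulVec (x : NSIndex M → ℝ) (m : Fin (M + 1)) :
    (nsGram q h M *ᵥ x) (Sum.inr m) + (realLattice q h M *ᵥ fun m' => x (Sum.inr m')) m
      = (q : ℝ) ^ (m : ℕ) * degH q h M x + degV q h M x := by
  rw [nsGram_mulVec_inr, degH_eq, degV_eq]
  have hS : (realLattice q h M *ᵥ fun m' => x (Sum.inr m')) m
      = ∑ m' : Fin (M + 1), (q : ℝ) ^ min (m : ℕ) m'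
          * (powerSum (frobRoots h) (Nat.dist m m')).re * x (Sum.inr m') := by
    simp [mulVec, dotProduct, realLattice]
  have hsum : (∑ m' : Fin (M + 1),
        (q : ℝ) ^ min (m : ℕ) m' * pointCount q h (Nat.dist m m') * x (Sum.inr m'))
      + ∑ m' : Fin (M + 1), (q : ℝ) ^ min (m : ℕ) m'
          * (powerSum (frobRoots h) (Nat.dist m m')).re * x (Sum.inr m')
      = (q : ℝ) ^ (m : ℕ) * ∑ m' : Fin (M + 1), x (Sum.inr m')
          + ∑ m' : Fin (M + 1), (q : ℝ) ^ (m' : ℕ) * x (Sum.inr m') := by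
    rw [← Finset.sum_add_distrib, Finset.mul_sum, ← Finset.sum_add_distrib]
    refine Finset.sum_congr rfl fun m' _ => ?_
    have e := pow_min_mul_pointCount_add q h (m : ℕ) m'
    calc (q : ℝ) ^ min (m : ℕ) m' * pointCount q h (Nat.dist m m') * x (Sum.inr m')
          + (q : ℝ) ^ min (m : ℕ) m' * (powerSum (frobRoots h) (Nat.dist m m')).re * x (Sum.inr m')
        = ((q : ℝ) ^ min (m : ℕ) m' * pointCount q h (Nat.dist m m')
            + (q : ℝ) ^ min (m : ℕ) m' * (powerSum (frobRoots h) (Nat.dist m m')).re)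
            * x (Sum.inr m') := by ring
      _ = ((q : ℝ) ^ (m : ℕ) + (q : ℝ) ^ (m' : ℕ)) * x (Sum.inr m') := by rw [e]
      _ = (q : ℝ) ^ (m : ℕ) * x (Sum.inr m') + (q : ℝ) ^ (m' : ℕ) * x (Sum.inr m') := by ring
  rw [hS]
  linear_combination hsum

/-- **THE RADICAL OF THE WINDOW FORM.**  A class `x = aH + bV + Σ c_m Γ_m` is numerically trivial on
`span{H, V, Γ_0, …, Γ_M}` iff `x·H = x·V = 0` and `S_M c = 0` — the null classes are exactly the
Castelnuovo–Severi EQUALITY relations `Σ c_m Γ'_m ≡ 0` (FFCAL §5), for every datum `(q, h)`. [folklore] -/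
theorem nsGram_mulVec_eq_zero_iff (x : NSIndex M → ℝ) :
    nsGram q h M *ᵥ x = 0 ↔ degH q h M x = 0 ∧ degV q h M x = 0
      ∧ realLattice q h M *ᵥ (fun m => x (Sum.inr m)) = 0 := by
  constructor
  · intro h0
    have hH : degH q h M x = 0 := by simp only [degH, h0, Pi.zero_apply]
    have hV : degV q h M x = 0 := by simp only [degV, h0, Pi.zero_apply]
    refine ⟨hH, hV, funext fun m => ?_⟩
    have e := nsGram_mulVec_inr_add_realLattice_mulVec q h M x m
    rw [h0, hH, hV, Pi.zero_apply, zero_add, mul_zero, zero_add] at e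
    exact e
  · rintro ⟨hH, hV, hS⟩
    funext i
    rcases i with i | m
    · fin_cases i
      · simpa [degH] using hH
      · simpa [degV] using hV
    · have e := nsGram_mulVec_inr_add_realLattice_mulVec q h M x m
      rw [hS, hH, hV, Pi.zero_apply, add_zero, mul_zero, zero_add] at e
      exact e

/-- `S_M c = 0 ⟺ T_M (D c) = 0`, `D = diag((√q)^m)` (`S_M = D (2T_M) D`, `q ≥ 1`). [folklore] -/
theorem realLattice_mulVec_eq_zero_iff_weil (hq : 0 < q) (c : Fin (M + 1) → ℝ) :
    realLattice q h M *ᵥ c = 0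
      ↔ weilWindowForm (q : ℝ) h M *ᵥ (fun m : Fin (M + 1) => (Real.sqrt q : ℂ) ^ (m : ℕ) * (c m : ℂ)) = 0 := by
  have hmap : ∀ m, (((realLattice q h M *ᵥ c) m : ℝ) : ℂ)
      = (latticeMatrix q (frobRoots h) M *ᵥ fun m => (c m : ℂ)) m := by
    intro m
    rw [← realLattice_map_ofReal]
    exact RingHom.map_mulVec Complex.ofRealHom (realLattice q h M) c m
  have h1 : realLattice q h M *ᵥ c = 0
      ↔ (latticeMatrix q (frobRoots h) M *ᵥ fun m => (c m : ℂ)) = 0 := by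
    constructor
    · intro h0; funext m; rw [← hmap m, h0]; simp
    · intro h0; funext m
      have e := hmap m
      rw [h0, Pi.zero_apply] at e
      exact_mod_cast e
  have hs : (Real.sqrt q : ℂ) ≠ 0 := by
    exact_mod_cast (Real.sqrt_pos.2 (by exact_mod_cast hq : (0 : ℝ) < q)).ne'
  have hD : IsUnit (sqrtDiag q M) := by
    rw [isUnit_iff_isUnit_det, det_sqrtDiag]
    exact (pow_ne_zero _ hs).isUnit
  have hinj : Function.Injective (sqrtDiag q M).mulVec := Matrix.mulVec_injective_iff_isUnit.2 hD
  have hDc : (sqrtDiag q M *ᵥ fun m => (c m : ℂ)) = fun m : Fin (M + 1) => (Real.sqrt q : ℂ) ^ (m : ℕ) * (c m : ℂ) := by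
    funext m; simp [sqrtDiag, mulVec_diagonal]
  rw [h1, latticeMatrix_eq hq, ← mulVec_mulVec, ← mulVec_mulVec, Matrix.smul_mulVec, hDc, weilWindowForm]
  constructor
  · intro h0
    have h2 := hinj (h0.trans (mulVec_zero _).symm)
    simpa using h2
  · intro h0
    rw [h0, smul_zero, mulVec_zero]

/-- `S_M c = 0 ⟺ Σ_m c_m α^m = 0` at EVERY Frobenius eigenvalue `α` (RH(q,h), `q ≥ 1`; the cliff file's
kernel theorem `weilWindowForm_mulVec_eq_zero_iff` transported through `D`). [folklore] -/
theorem realLattice_mulVec_eq_zero_iff_frob (hq : 0 < q) (hRH : ∀ α ∈ frobRoots h, ‖α‖ = Real.sqrt q)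
    (c : Fin (M + 1) → ℝ) :
    realLattice q h M *ᵥ c = 0
      ↔ ∀ α ∈ frobRoots h, ∑ m : Fin (M + 1), (c m : ℂ) * α ^ (m : ℕ) = 0 := by
  have hq' : (0 : ℝ) < q := by exact_mod_cast hq
  have hs : (Real.sqrt q : ℂ) ≠ 0 := by exact_mod_cast (Real.sqrt_pos.2 hq').ne'
  rw [realLattice_mulVec_eq_zero_iff_weil q h M hq, weilWindowForm_mulVec_eq_zero_iff hq' hRH]
  refine forall₂_congr fun α _ => ?_
  rw [Finset.sum_congr rfl fun (m : Fin (M + 1)) _ =>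
    (show (Real.sqrt q : ℂ) ^ (m : ℕ) * (c m : ℂ) * (α / (Real.sqrt q : ℂ)) ^ (m : ℕ)
        = (c m : ℂ) * α ^ (m : ℕ) by rw [div_pow]; field_simp)]

/-- **RADICAL = FROBENIUS RELATIONS** (RH(q,h), `q ≥ 1`): `x = aH + bV + Σ c_m Γ_m` is numerically
trivial iff `x·H = x·V = 0` and the polynomial `Σ c_m X^m` vanishes at every Frobenius eigenvalue —
for a curve: iff `Σ c_m F^m = 0` in `End(Jac C) ⊗ ℚ` (semisimplicity), the classical source of the
relations among the graphs `Γ_m`.  With the cliff file: the radical has the dimension of the multiples of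
`rad ∏(X − α)` of degree `≤ M`, i.e. `(M + 1 − D)⁺` — FFCAL's `n₀`; that count is not restated here.
[folklore] -/
theorem nsGram_mulVec_eq_zero_iff_frob (hq : 0 < q) (hRH : ∀ α ∈ frobRoots h, ‖α‖ = Real.sqrt q)
    (x : NSIndex M → ℝ) :
    nsGram q h M *ᵥ x = 0 ↔ degH q h M x = 0 ∧ degV q h M x = 0
      ∧ ∀ α ∈ frobRoots h, ∑ m : Fin (M + 1), (x (Sum.inr m) : ℂ) * α ^ (m : ℕ) = 0 := by
  rw [nsGram_mulVec_eq_zero_iff, realLattice_mulVec_eq_zero_iff_frob q h M hq hRH]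

end Summit.RiemannHypothesis.RiemannHypothesis.Theorems.MotivicDoor.FfHodgeSignature
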